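import Mathlib.MeasureTheory.Measure.Prokhorov
import Mathlib.MeasureTheory.Measure.LevyProkhorovMetric
import Summits.RiemannHypothesis.RiemannHypothesis.Theorems.LeeYangLeeyangThesisStubB1
import Summits.RiemannHypothesis.RiemannHypothesis.Theorems.LeeYangLeeyangThesisRealToComplex
import Literature.Probability.LatticeModels.IsingLimitLawLaplace
import HarnessLib

/-!
# RiemannHypothesis / LeeYang — crux `LeeyangThesis`, line `Sketch`: string laws EXIST (B1-existence)

B1 (`stub_B1`) says: a probability law with Gaussian moments whose Laplace transform is the end value
of a finite-length Kreĭn string with non-decreasing density is an Ising limit law. Here the law is not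
given in advance: if the REAL end values `F(r) = lim_{x → L⁻} φ(x, -r²)` of such a string exist and
grow sub-Gaussianly (`F(r) ≤ C_b e^{b r²}` for every `b > 0`), then there IS a probability law `ν`
with `∫ e^{ru} dν = F(r)`, all Gaussian moments finite, which is an Ising limit law
(`exists_isingLimitLaw_of_string`). With this, every explicit monotone-density string with controlled
real transfer growth (e.g. the card's accelerating-telegraph calibration) is a certified member of the
Griffiths–Simon class. Ingredients: the chain approximants along the exhaustion
(`exists_chain_approximants`, from `stub_stepApprox`, `stub_stringSteps`, `stub_chainMarkovPlain`,
`stub_phiMono`), the Gaussian-average moment bound, tightness from the `e^{u²}`-moment, Prokhorov,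
and identification of the transform along a subsequence
(`Literature.Probability.LatticeModels.tendsto_integral_of_tendsto_of_exp_sq_bound`).
-/

noncomputable section

-- single-problem summit namespace `Summit.RiemannHypothesis.RiemannHypothesis.…` (D-0017)
set_option linter.dupNamespace false

open MeasureTheory Filter Topology Complex Set
open scoped ENNReal NNReal
open Literature.Analysis.InverseSpectral Literature.Probability.LatticeModels ProbabilityTheory

namespace Summit.RiemannHypothesis.RiemannHypothesis.Theorems.LeeYangTelegraphString

/-! ### Chain approximants along the exhaustion -/

/-- **Chain approximants.** For a finite-length Kreĭn string `S` with non-decreasing density there are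
finite ferromagnetic chains whose laws `μ_k` have Laplace transforms (i) dominated on the real axis by
`Re φ_S(x_k, -r²)` and (ii) `1/(k+1)`-close to `φ_S(x_k, -h²)` for `‖h²‖ ≤ k + 1`, where
`x_k = S.exhaust k ↑ L`. [folklore] -/
theorem exists_chain_approximants (S : KreinString) (L : ℝ) (ρ : ℝ → ℝ) (hL : 0 < L)
    (hρm : Measurable ρ) (hmono : MonotoneOn ρ (Set.Iio L)) (hρ0 : ∀ y < 0, ρ y = 0)
    (hlen : S.length = ENNReal.ofReal L)
    (hmass : S.massMeasure = (volume.withDensity fun y => ENNReal.ofReal (ρ y)).restrict (Set.Iio L)) :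
    ∃ (n : ℕ → ℕ) (J : ∀ k, Fin (n k) → Fin (n k) → ℝ) (w : ∀ k, Fin (n k) → ℝ),
      (∀ k i j, 0 ≤ J k i j) ∧ (∀ k i, 0 ≤ w k i) ∧
      (∀ (k : ℕ) (r : ℝ), ∫ u, Real.exp (r * u) ∂(isingMagnetizationLaw (n k) (J k) (w k) : Measure ℝ) ≤
        (S.phi (-((r ^ 2 : ℝ) : ℂ)) (S.exhaust k)).re) ∧
      ∀ (k : ℕ) (h : ℂ), ‖h‖ ^ 2 ≤ (k : ℝ) + 1 →
        ‖(∫ u, cexp (h * u) ∂(isingMagnetizationLaw (n k) (J k) (w k) : Measure ℝ)) -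
          S.phi (-h ^ 2) (S.exhaust k)‖ ≤ 1 / ((k : ℝ) + 1) := by
  set x : ℕ → ℝ := S.exhaust with hx
  have hxdom : ∀ k, x k ∈ S.dom := S.exhaust_mem_dom
  have happ := fun k => stub_stepApprox S L ρ hL hρm hmono hρ0 hlen hmass (x k) (hxdom k)
    (1 / ((k : ℝ) + 1)) (by positivity) ((k : ℝ) + 1)
  choose N s d hsmono hs0 hsx hd hT using happ
  have hTex : ∀ k, ∃ T : KreinString, T.length = ⊤ ∧ T.massMeasure = volume.withDensity
      (fun y => ENNReal.ofReal (∑ j : Fin (N k), (Set.Ici (s k j)).indicator (fun _ => d k j) y)) :=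
    fun k => exists_stepString (N k) (s k) (d k) (hs0 k) (fun j => (hd k j).le)
  choose T hTlen hTmass using hTex
  have hTdom : ∀ k, x k ∈ (T k).dom := fun k => ⟨(hxdom k).1, by simp [hTlen k]⟩
  have hdomin : ∀ k, (T k).massMeasure.restrict (Set.Iic (x k)) ≤
      S.massMeasure.restrict (Set.Iic (x k)) := fun k => (hT k (T k) (hTlen k) (hTmass k)).1
  have hclose : ∀ k : ℕ, ∀ z : ℂ, ‖z‖ ≤ (k : ℝ) + 1 →
      ‖(T k).phi z (x k) - S.phi z (x k)‖ ≤ 1 / ((k : ℝ) + 1) :=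
    fun k => (hT k (T k) (hTlen k) (hTmass k)).2
  set ℓ : ∀ k, Fin (N k) → ℝ := fun k j =>
    (if hj : (j : ℕ) + 1 < N k then s k ⟨(j : ℕ) + 1, hj⟩ else x k) - s k j with hℓ
  set P : ∀ k, Fin (N k) → ℝ := fun k j => Real.sqrt (∑ i ∈ Finset.Iic j, d k i) with hP
  have hℓ0 : ∀ k j, 0 ≤ ℓ k j := by
    intro k j
    simp only [hℓ]
    split_ifs with hj
    · exact sub_nonneg.2 ((hsmono k).monotone (Fin.le_iff_val_le_val.2 (Nat.le_succ _)))
    · exact sub_nonneg.2 (hsx k j)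
  have hPpos : ∀ k j, 0 < P k j := by
    intro k j
    simp only [hP]
    refine Real.sqrt_pos.2 (Finset.sum_pos (fun i _ => hd k i) ⟨j, Finset.mem_Iic.2 le_rfl⟩)
  have hPmono : ∀ k, StrictMono (P k) := by
    intro k i j hij
    simp only [hP]
    refine Real.sqrt_lt_sqrt (Finset.sum_nonneg fun i _ => (hd k i).le) ?_
    refine Finset.sum_lt_sum_of_subset (Finset.Iic_subset_Iic.2 hij.le) (i := j)
      (Finset.mem_Iic.2 le_rfl) (fun h => (not_le.2 hij) (Finset.mem_Iic.1 h)) (hd k j)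
      (fun i _ _ => (hd k i).le)
  have hchain := fun k => stub_chainMarkovPlain (N k) (ℓ k) (P k) (hℓ0 k) (hPpos k) (hPmono k)
  choose n J w hJ hw hmgf using hchain
  have hdict : ∀ k (h : ℂ), ∫ u, cexp (h * u) ∂(isingMagnetizationLaw (n k) (J k) (w k) : Measure ℝ) =
      (T k).phi (-h ^ 2) (x k) := by
    intro k h
    rw [hmgf k h, stub_stringSteps (N k) (s k) (d k) (hsmono k) (hs0 k) (hd k) (T k) (hTlen k)
      (hTmass k) (x k) (hxdom k).1 (hsx k) h]
  refine ⟨n, J, w, hJ, hw, fun k r => ?_, fun k h hh => ?_⟩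
  · have hr2 : -(r : ℂ) ^ 2 = -((r ^ 2 : ℝ) : ℂ) := by push_cast; ring
    rw [integral_exp_mul_eq_re r (integrable_isingMagnetizationLaw _ _
      (by fun_prop : Continuous fun u : ℝ => cexp ((r : ℂ) * u)).stronglyMeasurable),
      hdict k (r : ℂ), hr2]
    exact stub_phiMono S (T k) (x k) (hxdom k) (hTdom k) (hdomin k) (r ^ 2) (sq_nonneg r) (x k)
      ⟨(hxdom k).1, le_rfl⟩
  · rw [hdict k h]
    exact hclose k _ (by rwa [norm_neg, norm_pow])

/-! ### Gaussian integrals -/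

/-- `∫⁻ e^{g²/4} dγ(g) < ∞` for the standard Gaussian. [folklore] -/
theorem lintegral_exp_sq_div_four_gaussian_lt_top :
    ∫⁻ g, ENNReal.ofReal (Real.exp (g ^ 2 / 4)) ∂(gaussianReal 0 1) < ⊤ := by
  rw [gaussianReal_of_var_ne_zero 0 one_ne_zero, gaussianPDF_def,
    lintegral_withDensity_eq_lintegral_mul _ (measurable_gaussianPDFReal 0 1).ennreal_ofReal
      (by fun_prop : Measurable fun g : ℝ => ENNReal.ofReal (Real.exp (g ^ 2 / 4)))]
  have hint : Integrable (fun g : ℝ => (√(2 * Real.pi * (1 : ℝ≥0)))⁻¹ * Real.exp (-(1 / 4) * g ^ 2)) :=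
    (integrable_exp_neg_mul_sq (by norm_num : (0 : ℝ) < 1 / 4)).const_mul _
  refine lt_of_le_of_lt (le_of_eq ?_) hint.lintegral_lt_top
  rw [← lintegral_enorm_of_nonneg (f := fun g : ℝ => (√(2 * Real.pi * (1 : ℝ≥0)))⁻¹ *
    Real.exp (-(1 / 4) * g ^ 2)) fun g => by positivity]
  refine lintegral_congr fun g => ?_
  simp only [Pi.mul_apply, gaussianPDFReal, NNReal.coe_one, sub_zero, mul_one]
  rw [← ENNReal.ofReal_mul (by positivity), Real.enorm_eq_ofReal (by positivity), mul_assoc,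
    ← Real.exp_add]
  congr 2
  ring_nf

/-! ### B1-existence -/

/-- **String laws exist and are Ising limit laws.** Let `S` be a Kreĭn string of finite length `L`
with mass `ρ(y) dy` on `(-∞, L)`, `ρ` measurable, non-decreasing on `(-∞, L)` and zero on `(-∞, 0)`.
If the real end values `F(r) = lim_{x → L⁻} Re φ(x, -r²)` exist for every real `r` and grow
sub-Gaussianly (`F(r) ≤ C_b e^{b r²}` for every `b > 0`), then there is a probability law `ν` on `ℝ`
with Laplace transform `∫ e^{ru} dν = F(r)`, all Gaussian moments finite, which is an Ising limit
law. (Chain approximants; uniform Gaussian moments by the Gaussian average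
`∫ e^{bu²} dμ_k ≤ E_G F(√(2b) G)`; tightness and Prokhorov; identification of the transform along a
convergent subsequence.) [folklore] -/
theorem exists_isingLimitLaw_of_string (S : KreinString) (L : ℝ) (ρ : ℝ → ℝ) (hL : 0 < L)
    (hρm : Measurable ρ) (hmono : MonotoneOn ρ (Set.Iio L)) (hρ0 : ∀ y < 0, ρ y = 0)
    (hlen : S.length = ENNReal.ofReal L)
    (hmass : S.massMeasure = (volume.withDensity fun y => ENNReal.ofReal (ρ y)).restrict (Set.Iio L))
    (F : ℝ → ℝ) (hF : ∀ r : ℝ, Tendsto (fun x => (S.phi (-((r ^ 2 : ℝ) : ℂ)) x).re) S.toEnd (𝓝 (F r)))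
    (hgrowth : ∀ b : ℝ, 0 < b → ∃ C : ℝ, ∀ r : ℝ, F r ≤ C * Real.exp (b * r ^ 2)) :
    ∃ ν : ProbabilityMeasure ℝ, IsIsingLimitLaw ν ∧
      (∀ b : ℝ, Integrable (fun u : ℝ => Real.exp (b * u ^ 2)) (ν : Measure ℝ)) ∧
      ∀ r : ℝ, ∫ u, Real.exp (r * u) ∂(ν : Measure ℝ) = F r := by
  obtain ⟨n, J, w, hJ, hw, hdomR, hclose⟩ :=
    exists_chain_approximants S L ρ hL hρm hmono hρ0 hlen hmass
  set μ : ℕ → ProbabilityMeasure ℝ := fun k => isingMagnetizationLaw (n k) (J k) (w k) with hμ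
  have hxdom : ∀ k, S.exhaust k ∈ S.dom := S.exhaust_mem_dom
  -- real transforms are bounded by `F`
  have hFge : ∀ k (r : ℝ), (S.phi (-((r ^ 2 : ℝ) : ℂ)) (S.exhaust k)).re ≤ F r := fun k r =>
    le_of_monotoneOn_of_tendsto S (S.monotoneOn_phi_neg_re (sq_nonneg r)) (hF r) (hxdom k)
  have hmgf_le : ∀ k (r : ℝ), ∫ u, Real.exp (r * u) ∂(μ k : Measure ℝ) ≤ F r :=
    fun k r => (hdomR k r).trans (hFge k r)
  have hF0 : ∀ r, 0 ≤ F r := fun r =>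
    (integral_nonneg fun u => (Real.exp_pos _).le).trans (hmgf_le 0 r)
  -- uniform Gaussian moments
  have hmomk : ∀ b : ℝ, ∃ C : ℝ, ∀ k, ∫ u, Real.exp (b * u ^ 2) ∂(μ k : Measure ℝ) ≤ C := by
    intro b
    by_cases hb : b ≤ 0
    · refine ⟨1, fun k => ?_⟩
      calc ∫ u, Real.exp (b * u ^ 2) ∂(μ k : Measure ℝ) ≤ ∫ _u, (1 : ℝ) ∂(μ k : Measure ℝ) := by
            refine integral_mono (integrable_isingMagnetizationLaw _ _
              (by fun_prop : Continuous fun u : ℝ => Real.exp (b * u ^ 2)).stronglyMeasurable)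
              (integrable_const _) fun u => ?_
            exact Real.exp_le_one_iff.2 (mul_nonpos_of_nonpos_of_nonneg hb (sq_nonneg u))
        _ = 1 := by simp
    push Not at hb
    -- `F(√(2b) g) ≤ C e^{g²/4}` with `b' = 1/(8b)`
    obtain ⟨C, hC⟩ := hgrowth (1 / (8 * b)) (by positivity)
    have hC0 : 0 ≤ C := by
      have := (hF0 0).trans (hC 0)
      simpa using this
    set I : ℝ≥0∞ := ∫⁻ g, ENNReal.ofReal (Real.exp (g ^ 2 / 4)) ∂(gaussianReal 0 1) with hI
    have hItop : I < ⊤ := lintegral_exp_sq_div_four_gaussian_lt_top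
    refine ⟨(ENNReal.ofReal C * I).toReal, fun k => ?_⟩
    have hik : Integrable (fun u => Real.exp (b * u ^ 2)) (μ k : Measure ℝ) :=
      integrable_isingMagnetizationLaw _ _
        (by fun_prop : Continuous fun u : ℝ => Real.exp (b * u ^ 2)).stronglyMeasurable
    have hbound : ∫⁻ u, ENNReal.ofReal (Real.exp (b * u ^ 2)) ∂(μ k : Measure ℝ) ≤
        ENNReal.ofReal C * I := by
      rw [lintegral_exp_mul_sq_eq_gaussian_average (μ k : Measure ℝ) b hb.le, hI,
        ← lintegral_const_mul _ (by fun_prop : Measurable fun g : ℝ => ENNReal.ofReal (Real.exp (g ^ 2 / 4)))]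
      refine lintegral_mono fun g => ?_
      have hi1 : Integrable (fun u => Real.exp (Real.sqrt (2 * b) * g * u)) (μ k : Measure ℝ) :=
        integrable_isingMagnetizationLaw _ _
          (by fun_prop : Continuous fun u : ℝ => Real.exp (Real.sqrt (2 * b) * g * u)).stronglyMeasurable
      rw [← ofReal_integral_eq_lintegral_ofReal hi1 (Eventually.of_forall fun u => (Real.exp_pos _).le),
        ← ENNReal.ofReal_mul hC0]
      refine ENNReal.ofReal_le_ofReal ((hmgf_le k _).trans ((hC _).trans ?_))
      refine mul_le_mul_of_nonneg_left (Real.exp_le_exp.2 (le_of_eq ?_)) hC0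
      rw [mul_pow, Real.sq_sqrt (by positivity)]
      field_simp
      ring
    have hlt : ENNReal.ofReal C * I < ⊤ := ENNReal.mul_lt_top ENNReal.ofReal_lt_top hItop
    rw [← ENNReal.ofReal_le_ofReal_iff ENNReal.toReal_nonneg, ENNReal.ofReal_toReal hlt.ne,
      ofReal_integral_eq_lintegral_ofReal hik (Eventually.of_forall fun u => (Real.exp_pos _).le)]
    exact hbound
  -- tightness from the `e^{u²}`-moment, Prokhorov, a convergent subsequence
  obtain ⟨C₁, hC₁⟩ := hmomk 1
  have hint1 : ∀ k, Integrable (fun u => Real.exp (u ^ 2)) (μ k : Measure ℝ) := fun k =>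
    integrable_isingMagnetizationLaw _ _
      (by fun_prop : Continuous fun u : ℝ => Real.exp (u ^ 2)).stronglyMeasurable
  have hC₁' : ∀ k, ∫ u, Real.exp (u ^ 2) ∂(μ k : Measure ℝ) ≤ C₁ := fun k => by
    simpa only [one_mul] using hC₁ k
  have htight : IsTightMeasureSet {((m : ProbabilityMeasure ℝ) : Measure ℝ) | m ∈ Set.range μ} := by
    rw [isTightMeasureSet_iff_exists_isCompact_measure_compl_le]
    intro ε hε
    -- choose `R` with `C₁ / e^{R²} ≤ ε`
    have hC₁0 : 0 ≤ C₁ := (integral_nonneg fun u => (Real.exp_pos _).le).trans (hC₁' 0)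
    obtain ⟨R, hR⟩ : ∃ R : ℝ, 0 < R ∧ ENNReal.ofReal (C₁ / Real.exp (R ^ 2)) ≤ ε := by
      by_cases hεtop : ε = ⊤
      · exact ⟨1, one_pos, hεtop ▸ le_top⟩
      have hε' : 0 < ε.toReal := ENNReal.toReal_pos hε.ne' hεtop
      obtain ⟨R, hR1, hR⟩ : ∃ R : ℝ, 1 ≤ R ∧ C₁ / ε.toReal ≤ R := ⟨max 1 (C₁ / ε.toReal), le_max_left _ _,
        le_max_right _ _⟩
      refine ⟨R, by linarith, ?_⟩
      rw [← ENNReal.ofReal_toReal hεtop]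
      refine ENNReal.ofReal_le_ofReal ?_
      rw [div_le_iff₀ (Real.exp_pos _)]
      have h1 : R ≤ Real.exp (R ^ 2) := by
        have := Real.add_one_le_exp (R ^ 2)
        nlinarith
      calc C₁ ≤ R * ε.toReal := by rwa [div_le_iff₀ hε'] at hR
        _ ≤ Real.exp (R ^ 2) * ε.toReal := by gcongr
        _ = ε.toReal * Real.exp (R ^ 2) := mul_comm _ _
    refine ⟨Set.Icc (-R) R, isCompact_Icc, ?_⟩
    rintro _ ⟨m, ⟨k, rfl⟩, rfl⟩
    refine le_trans ?_ hR.2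
    -- Chebyshev: `μ_k {|u| > R} ≤ (∫ e^{u²}) / e^{R²}`
    have hsub : (Set.Icc (-R) R)ᶜ ⊆ {u : ℝ | Real.exp (R ^ 2) ≤ Real.exp (u ^ 2)} := by
      intro u hu
      simp only [Set.mem_compl_iff, Set.mem_Icc, not_and_or, not_le] at hu
      simp only [Set.mem_setOf_eq, Real.exp_le_exp]
      rcases hu with hu | hu <;> nlinarith
    have hcheb := mul_meas_ge_le_integral_of_nonneg (μ := (μ k : Measure ℝ))
      (Eventually.of_forall fun u => (Real.exp_pos (u ^ 2)).le) (hint1 k) (Real.exp (R ^ 2))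
    calc ((μ k : Measure ℝ)) (Set.Icc (-R) R)ᶜ
        ≤ (μ k : Measure ℝ) {u : ℝ | Real.exp (R ^ 2) ≤ Real.exp (u ^ 2)} := measure_mono hsub
      _ = ENNReal.ofReal ((μ k : Measure ℝ).real {u : ℝ | Real.exp (R ^ 2) ≤ Real.exp (u ^ 2)}) :=
          (ENNReal.ofReal_toReal (measure_ne_top _ _)).symm
      _ ≤ ENNReal.ofReal (C₁ / Real.exp (R ^ 2)) := by
          refine ENNReal.ofReal_le_ofReal ?_
          rw [le_div_iff₀ (Real.exp_pos _), mul_comm]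
          exact hcheb.trans (hC₁' k)
  have hcomp : IsCompact (closure (Set.range μ)) := isCompact_closure_of_isTightMeasureSet htight
  obtain ⟨ν, -, φ, hφ, hlim0⟩ := hcomp.tendsto_subseq (x := μ) fun k => subset_closure ⟨k, rfl⟩
  have hlim : Tendsto (fun j => μ (φ j)) atTop (𝓝 ν) := hlim0
  -- identification of the Laplace transform along the subsequence
  have hidR : ∀ r : ℝ, ∫ u, Real.exp (r * u) ∂(ν : Measure ℝ) = F r := by
    intro r
    have hg : Continuous fun u : ℝ => cexp ((r : ℂ) * u) := by fun_prop
    have h1 : Tendsto (fun j => ∫ u, cexp ((r : ℂ) * u) ∂(μ (φ j) : Measure ℝ)) atTop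
        (𝓝 (∫ u, cexp ((r : ℂ) * u) ∂(ν : Measure ℝ))) :=
      tendsto_integral_of_tendsto_of_exp_sq_bound hlim (fun j => hint1 (φ j)) (fun j => hC₁' (φ j)) hg
        (A := |r|) fun u => by simpa using norm_cexp_mul_ofReal_le (r : ℂ) u
    -- the same integrals converge to `F r`
    have h2 : Tendsto (fun j => ∫ u, cexp ((r : ℂ) * u) ∂(μ (φ j) : Measure ℝ)) atTop (𝓝 ((F r : ℝ) : ℂ)) := by
      have hr2 : ∀ y, S.phi (-(r : ℂ) ^ 2) y = S.phi (-((r ^ 2 : ℝ) : ℂ)) y := fun y => by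
        congr 1; push_cast; ring
      -- `φ_S(x_k, -r²) → F r` (real values)
      have hS : Tendsto (fun k => S.phi (-(r : ℂ) ^ 2) (S.exhaust k)) atTop (𝓝 ((F r : ℝ) : ℂ)) := by
        have hre := (hF r).comp S.tendsto_exhaust
        have : ∀ k, S.phi (-(r : ℂ) ^ 2) (S.exhaust k) =
            (((S.phi (-((r ^ 2 : ℝ) : ℂ)) (S.exhaust k)).re : ℝ) : ℂ) := fun k => by
          rw [hr2]
          exact Complex.ext (by rw [Complex.ofReal_re]) (by rw [Complex.ofReal_im, S.phi_neg_im])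
        simp_rw [this]
        exact (Complex.continuous_ofReal.tendsto _).comp hre
      have hdiff : Tendsto (fun k => (∫ u, cexp ((r : ℂ) * u) ∂(μ k : Measure ℝ)) -
          S.phi (-(r : ℂ) ^ 2) (S.exhaust k)) atTop (𝓝 0) := by
        rw [tendsto_zero_iff_norm_tendsto_zero]
        have hbound : ∀ᶠ k : ℕ in atTop, ‖(∫ u, cexp ((r : ℂ) * u) ∂(μ k : Measure ℝ)) -
            S.phi (-(r : ℂ) ^ 2) (S.exhaust k)‖ ≤ 1 / ((k : ℝ) + 1) := by
          obtain ⟨K, hK⟩ := exists_nat_ge (r ^ 2)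
          refine eventually_atTop.2 ⟨K, fun k hk => hclose k _ ?_⟩
          rw [Complex.norm_real, Real.norm_eq_abs, sq_abs]
          exact hK.trans (by exact_mod_cast Nat.le_succ_of_le hk)
        exact squeeze_zero' (Eventually.of_forall fun k => norm_nonneg _) hbound
          tendsto_one_div_add_atTop_nhds_zero_nat
      have h3 := (hdiff.comp hφ.tendsto_atTop).add (hS.comp hφ.tendsto_atTop)
      rw [zero_add] at h3
      refine h3.congr fun j => ?_
      simp only [Function.comp_apply, sub_add_cancel]
    have heq := tendsto_nhds_unique h1 h2
    have hintν : Integrable (fun u : ℝ => cexp ((r : ℂ) * u)) (ν : Measure ℝ) := by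
      have := integrable_exp_mul_sq_of_tendsto hlim (b := 1) (C := C₁)
        (fun j => by simpa only [one_mul] using hint1 (φ j)) (fun j => hC₁ (φ j))
      exact integrable_cexp_mul_of_exp_sq this.1 r
    rw [integral_exp_mul_eq_re r hintν, heq, Complex.ofReal_re]
  refine ⟨ν, ⟨fun j => n (φ j), fun j => J (φ j), fun j => w (φ j), fun j => hJ (φ j),
    fun j => hw (φ j), hlim, fun b => ?_⟩, fun b => ?_, hidR⟩
  · obtain ⟨C, hC⟩ := hmomk b
    exact ⟨C, fun j => hC (φ j)⟩
  · obtain ⟨C, hC⟩ := hmomk b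
    exact (integrable_exp_mul_sq_of_tendsto hlim (b := b) (C := C)
      (fun j => integrable_isingMagnetizationLaw _ _
        (by fun_prop : Continuous fun u : ℝ => Real.exp (b * u ^ 2)).stronglyMeasurable)
      (fun j => hC (φ j))).1

/-- **Stub B1exist (registered form of `exists_isingLimitLaw_of_string`).** A finite-length Kreĭn
string with non-decreasing density whose real end values exist with sub-Gaussian growth defines an
Ising limit law with those end values as its Laplace transform. [folklore] -/
theorem stub_B1exist : ∀ (S : KreinString) (L : ℝ) (ρ : ℝ → ℝ), 0 < L → Measurable ρ →
    MonotoneOn ρ (Set.Iio L) → (∀ y < 0, ρ y = 0) → S.length = ENNReal.ofReal L →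
    S.massMeasure = (volume.withDensity fun y => ENNReal.ofReal (ρ y)).restrict (Set.Iio L) →
    ∀ F : ℝ → ℝ, (∀ r : ℝ, Tendsto (fun x => (S.phi (-((r ^ 2 : ℝ) : ℂ)) x).re) S.toEnd (𝓝 (F r))) →
    (∀ b : ℝ, 0 < b → ∃ C : ℝ, ∀ r : ℝ, F r ≤ C * Real.exp (b * r ^ 2)) →
    ∃ ν : ProbabilityMeasure ℝ, IsIsingLimitLaw ν ∧
      (∀ b : ℝ, Integrable (fun u : ℝ => Real.exp (b * u ^ 2)) (ν : Measure ℝ)) ∧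
      ∀ r : ℝ, ∫ u, Real.exp (r * u) ∂(ν : Measure ℝ) = F r :=
  fun S L ρ hL hρm hmono hρ0 hlen hmass F hF hgrowth =>
    exists_isingLimitLaw_of_string S L ρ hL hρm hmono hρ0 hlen hmass F hF hgrowth

end Summit.RiemannHypothesis.RiemannHypothesis.Theorems.LeeYangTelegraphString

end
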